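import Summits.Ventures.CertifiedManyBodySolver.Certificates.HubbardSquare_n7o8_thermal_directSDP_fillingAffine
import Summits.Ventures.CertifiedManyBodySolver.Certificates.HubbardSquare_n7o8_thermal_cell_4t5_directSDP_C2floor_r354_r473
import Summits.Ventures.CertifiedManyBodySolver.Certificates.HubbardSquare_n7o8_thermal_cell_t1_directSDP_C2floor_r354_r473
import Literature.MathematicalPhysics.QuantumLattice.TypeClassSidecarReaderAllTori
import Literature.MathematicalPhysics.QuantumLattice.HubbardTTPrimeThermalPressureLimit
import HarnessLib

/-!
# Ventures/CertifiedManyBodySolver — `(U, n, t′) = (8, 7/8, 0)`: the direct-SDP T-axis cells RE-READ AT hubbard-thermal-eng-2's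
# SEAM-DRESSED C3 PRESSURE FLOORS by kernel algebra (input-affine plug through the filling-affine claim nodes; NO SDP re-run, no re-read)

HONEST FRAMING: first certified bounds; not a superconductivity verdict; every number certified or labelled float.
WHAT THIS IS NOT: not a phase sentence; not of record until the mbsolver LEAD pen + referee sign; every theorem below is CONDITIONAL on (i) the direct-SDP claim node
named in its statement (hubbard-thermal-eng-1, certsdp cert/0 triple-equal, landed: thC7a (p522743) / C13tp0b3 (p542219) via the filling-affine twins p552092; p586068 (β = 5/4),
p587709 (β = 1)) and (ii) the C3 pressure floor stated as a HYPOTHESIS BY VALUE `hW : W0 ≤ pressureTT' β 1 0 8 (7/8)` — hubbard-thermal-eng-2's seam-dressed type-class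
trial-state floors (kit j283801/j284209, 3 × 3 plaq layout, exact dyadic gates, in-job verify_c3 3/3 ACCEPT; JSONs `HOME/hubbard-thermal-eng-2/attempts/c3-j283801|j284209/
cert_c3_3x3_plaq_tp0_U8_<β>.json`, claim.W0), whose kernel node/reader (hubbard-thermal-p2/p1 C3-READER-SPEC) discharges `hW` when it lands. Point cells, not box words.

WHY (CERT-THERMAL §9 (e)/(f)): each certificate is affine in its free-energy input; the runs used p2's 3 × 3 C2 floors (β ≤ 3) or the T = 0 cap #445 (β = 4) as input `f₀`; a better
floor `W0` is an admissible input `f = −W0/β < f₀`, and the SAME multipliers certify `u₀ + K·(−W0/β − f₀)`.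
TABLE (10-dp outward; every β′ ≥ β; lower edge #473 −0.8372323499 throughout):
  `T ≤ t/4` (β ≥ 4): C3 floor W0 = 2.8545522677, input shift Δf = -0.0076979894, K = 1.1995905973 ⇒ e(ω) ≤ -0.4861772204 (was -0.4769427847; eng-2 C3 chord -0.4878737985)
  `T ≤ t/3` (β ≥ 3): C3 floor W0 = 2.2970735478, input shift Δf = -0.0450235526, K = 1.2432150243 ⇒ e(ω) ≤ -0.4551752472 (was -0.3992012902; eng-2 C3 chord -0.4569382778)
  `T ≤ 4t/5` (β ≥ 5/4): C3 floor W0 = 1.4059561530, input shift Δf = -0.0481368024, K = 1.5933245302 ⇒ e(ω) ≤ -0.3118226914 (was -0.2351251432; eng-2 C3 chord -0.3102800000)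
  `T ≤ t` (β ≥ 1): C3 floor W0 = 1.2976419744, input shift Δf = -0.0484631217, K = 1.7353573134 ⇒ e(ω) ≤ -0.2506395518 (was -0.1665387191; eng-2 C3 chord -0.2501830000)
At t′ = 0 eng-2's C3 CHORDS (genuine 3 × 2 anchors, WINDOW-C3-tp0-b4.md) are tighter at T ≤ t/4, t/3 by ≈ 2e-3 and the plugged direct cells are tighter at T ≤ 4t/5, t by
≈ 1e-3 (LP duality: a direct solve = the optimal-anchor chord for ITS caps; CERT-THERMAL §7) — the tree takes the min; both are conditional on the same C3 floors.
[cite: Israel1979, Lemma II.3.1] [cite: Ruelle1969, §3.4] [cite: FawziFawziScalet2024, Theorem 3.1]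
Seat prover-hubbard-thermal-eng-1-g3, 2026-08-27.
-/

noncomputable section

namespace Summit.Ventures.CertifiedManyBodySolver.Certificates

open Literature.MathematicalPhysics.QuantumLattice
open Literature.MathematicalPhysics.QuantumLattice.ThermodynamicLimit
open Literature.MathematicalPhysics.QuantumLattice.InfVolFermionState
open _root_.Filter
open scoped ComplexOrder

/-- **C3 PLUG, `T ≤ t/4` (every β′ ≥ 4) at (8, 7/8, 0):** the direct-SDP certificate behind `cert_thSDP_b4_thC7a_j264963` re-read at hubbard-thermal-eng-2's seam-dressed C3 floor
`W0(4) = 3138613410473 / 1099511627776` (≈ 2.8545522677; `HOME/hubbard-thermal-eng-2/attempts/c3-j283801/cert_c3_3x3_plaq_tp0_U8_b4.json`, claim.W0, in-job verify_c3 ACCEPT) through the filling-affine node at `n′ = 7/8`: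
`e(ω) ≤ u₀ + K·(−W0/β − f₀) = -0.4861772204…` ⇒ **`e(ω) ≤ -0.4861772204`** (10-dp outward; previous edge of this cell `-0.4769427847`, eng-2's own C3 chord `-0.4878737985`). The floor is a HYPOTHESIS BY VALUE (`hW`), discharged by
eng-2's C3 node when it lands (p2/p1 C3 reader); NO SDP re-run. [cite: Israel1979, Lemma II.3.1] [cite: Ruelle1969, §3.4] -/
theorem thermal_tp0_upper_directSDP_b4_C3plug_of_le (hSDP : cert_thSDP_b4_thC7a_j264963_fillingAffine)
    (hW : (3138613410473 / 1099511627776 : ℝ) ≤ pressureTT' 4 1 0 8 (7 / 8)) {β : ℝ} (hβ : (4 : ℝ) ≤ β) {ω : InfVolFermionState 2} {Ls : ℕ → ℕ}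
    (h : ω.IsTorusLimitOfMixture (sectorGibbsCount (7 / 8)) (fun L => sectorGibbsWeightTT' β 1 0 8 (7 / 8) L)
      (fun L => sectorGibbsVectorTT' 1 0 8 (7 / 8) L) Ls)
    (hLs : Tendsto Ls atTop atTop) :
    ω.meanEnergy (hubbardTTPrimeFermionInteraction 1 0 8) 1 ≤ (-0.4861772204 : ℝ) := by
  refine IsTorusLimitOfMixture.meanEnergy_hubbardTTPrime_le_of_forall_at_hotter_allTori (t := 1) (t' := 0) (U := 8) (n := 7 / 8)
    (by norm_num) (by norm_num) (by norm_num) hβ (fun ω₁ Ls₁ hLs₁ h₁ => ?_) hLs h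
  have h' := hSDP (7 / 8) (-(3138613410473 / 1099511627776 : ℝ) / 4) (by norm_num) (by norm_num)
    (div_le_div_of_nonneg_right (neg_le_neg hW) (by norm_num)) ω₁ Ls₁ hLs₁ h₁
  norm_num at h' ⊢
  linarith


/-- **C3 PLUG, `T ≤ t/3` (every β′ ≥ 3) at (8, 7/8, 0):** the direct-SDP certificate behind `cert_thSDP_tp0_b3_C13tp0b3_j276525` re-read at hubbard-thermal-eng-2's seam-dressed C3 floor
`W0(3) = 315707384459 / 137438953472` (≈ 2.2970735478; `HOME/hubbard-thermal-eng-2/attempts/c3-j283801/cert_c3_3x3_plaq_tp0_U8_b3.json`, claim.W0, in-job verify_c3 ACCEPT) through the filling-affine node at `n′ = 7/8`: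
`e(ω) ≤ u₀ + K·(−W0/β − f₀) = -0.4551752473…` ⇒ **`e(ω) ≤ -0.4551752472`** (10-dp outward; previous edge of this cell `-0.3992012902`, eng-2's own C3 chord `-0.4569382778`). The floor is a HYPOTHESIS BY VALUE (`hW`), discharged by
eng-2's C3 node when it lands (p2/p1 C3 reader); NO SDP re-run. [cite: Israel1979, Lemma II.3.1] [cite: Ruelle1969, §3.4] -/
theorem thermal_tp0_upper_directSDP_b3_C3plug_of_le (hSDP : cert_thSDP_tp0_b3_C13tp0b3_j276525_fillingAffine)
    (hW : (315707384459 / 137438953472 : ℝ) ≤ pressureTT' 3 1 0 8 (7 / 8)) {β : ℝ} (hβ : (3 : ℝ) ≤ β) {ω : InfVolFermionState 2} {Ls : ℕ → ℕ}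
    (h : ω.IsTorusLimitOfMixture (sectorGibbsCount (7 / 8)) (fun L => sectorGibbsWeightTT' β 1 0 8 (7 / 8) L)
      (fun L => sectorGibbsVectorTT' 1 0 8 (7 / 8) L) Ls)
    (hLs : Tendsto Ls atTop atTop) :
    ω.meanEnergy (hubbardTTPrimeFermionInteraction 1 0 8) 1 ≤ (-0.4551752472 : ℝ) := by
  refine IsTorusLimitOfMixture.meanEnergy_hubbardTTPrime_le_of_forall_at_hotter_allTori (t := 1) (t' := 0) (U := 8) (n := 7 / 8)
    (by norm_num) (by norm_num) (by norm_num) hβ (fun ω₁ Ls₁ hLs₁ h₁ => ?_) hLs h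
  have h' := hSDP (7 / 8) (-(315707384459 / 137438953472 : ℝ) / 3) (by norm_num) (by norm_num)
    (div_le_div_of_nonneg_right (neg_le_neg hW) (by norm_num)) ω₁ Ls₁ hLs₁ h₁
  norm_num at h' ⊢
  linarith


/-- **C3 PLUG, `T ≤ 4t/5` (every β′ ≥ 5/4) at (8, 7/8, 0):** the direct-SDP certificate behind `cert_thSDP_tp0_b5o4_P2tp0b5o4_j285254` re-read at hubbard-thermal-eng-2's seam-dressed C3 floor
`W0(5/4) = 1545865138371 / 1099511627776` (≈ 1.4059561530; `HOME/hubbard-thermal-eng-2/attempts/c3-j284209/cert_c3_3x3_plaq_tp0_U8_b5o4.json`, claim.W0, in-job verify_c3 ACCEPT) through the filling-affine node at `n′ = 7/8`: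
`e(ω) ≤ u₀ + K·(−W0/β − f₀) = -0.3118226914…` ⇒ **`e(ω) ≤ -0.3118226914`** (10-dp outward; previous edge of this cell `-0.2351251432`, eng-2's own C3 chord `-0.3102800000`). The floor is a HYPOTHESIS BY VALUE (`hW`), discharged by
eng-2's C3 node when it lands (p2/p1 C3 reader); NO SDP re-run. [cite: Israel1979, Lemma II.3.1] [cite: Ruelle1969, §3.4] -/
theorem thermal_tp0_upper_directSDP_b5o4_C3plug_of_le (hSDP : cert_thSDP_tp0_b5o4_P2tp0b5o4_j285254_fillingAffine)
    (hW : (1545865138371 / 1099511627776 : ℝ) ≤ pressureTT' (5 / 4) 1 0 8 (7 / 8)) {β : ℝ} (hβ : ((5 / 4) : ℝ) ≤ β) {ω : InfVolFermionState 2} {Ls : ℕ → ℕ}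
    (h : ω.IsTorusLimitOfMixture (sectorGibbsCount (7 / 8)) (fun L => sectorGibbsWeightTT' β 1 0 8 (7 / 8) L)
      (fun L => sectorGibbsVectorTT' 1 0 8 (7 / 8) L) Ls)
    (hLs : Tendsto Ls atTop atTop) :
    ω.meanEnergy (hubbardTTPrimeFermionInteraction 1 0 8) 1 ≤ (-0.3118226914 : ℝ) := by
  refine IsTorusLimitOfMixture.meanEnergy_hubbardTTPrime_le_of_forall_at_hotter_allTori (t := 1) (t' := 0) (U := 8) (n := 7 / 8)
    (by norm_num) (by norm_num) (by norm_num) hβ (fun ω₁ Ls₁ hLs₁ h₁ => ?_) hLs h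
  have h' := hSDP (7 / 8) (-(1545865138371 / 1099511627776 : ℝ) / (5 / 4)) (by norm_num) (by norm_num)
    (div_le_div_of_nonneg_right (neg_le_neg hW) (by norm_num)) ω₁ Ls₁ hLs₁ h₁
  norm_num at h' ⊢
  linarith


/-- **C3 PLUG, `T ≤ t` (every β′ ≥ 1) at (8, 7/8, 0):** the direct-SDP certificate behind `cert_thSDP_tp0_b1_P2tp0b1_j285672` re-read at hubbard-thermal-eng-2's seam-dressed C3 floor
`W0(1) = 713386219751 / 549755813888` (≈ 1.2976419744; `HOME/hubbard-thermal-eng-2/attempts/c3-j284209/cert_c3_3x3_plaq_tp0_U8_b1.json`, claim.W0, in-job verify_c3 ACCEPT) through the filling-affine node at `n′ = 7/8`: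
`e(ω) ≤ u₀ + K·(−W0/β − f₀) = -0.2506395519…` ⇒ **`e(ω) ≤ -0.2506395518`** (10-dp outward; previous edge of this cell `-0.1665387191`, eng-2's own C3 chord `-0.2501830000`). The floor is a HYPOTHESIS BY VALUE (`hW`), discharged by
eng-2's C3 node when it lands (p2/p1 C3 reader); NO SDP re-run. [cite: Israel1979, Lemma II.3.1] [cite: Ruelle1969, §3.4] -/
theorem thermal_tp0_upper_directSDP_b1_C3plug_of_le (hSDP : cert_thSDP_tp0_b1_P2tp0b1_j285672_fillingAffine)
    (hW : (713386219751 / 549755813888 : ℝ) ≤ pressureTT' 1 1 0 8 (7 / 8)) {β : ℝ} (hβ : (1 : ℝ) ≤ β) {ω : InfVolFermionState 2} {Ls : ℕ → ℕ}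
    (h : ω.IsTorusLimitOfMixture (sectorGibbsCount (7 / 8)) (fun L => sectorGibbsWeightTT' β 1 0 8 (7 / 8) L)
      (fun L => sectorGibbsVectorTT' 1 0 8 (7 / 8) L) Ls)
    (hLs : Tendsto Ls atTop atTop) :
    ω.meanEnergy (hubbardTTPrimeFermionInteraction 1 0 8) 1 ≤ (-0.2506395518 : ℝ) := by
  refine IsTorusLimitOfMixture.meanEnergy_hubbardTTPrime_le_of_forall_at_hotter_allTori (t := 1) (t' := 0) (U := 8) (n := 7 / 8)
    (by norm_num) (by norm_num) (by norm_num) hβ (fun ω₁ Ls₁ hLs₁ h₁ => ?_) hLs h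
  have h' := hSDP (7 / 8) (-(713386219751 / 549755813888 : ℝ) / 1) (by norm_num) (by norm_num)
    (div_le_div_of_nonneg_right (neg_le_neg hW) (by norm_num)) ω₁ Ls₁ hLs₁ h₁
  norm_num at h' ⊢
  linarith


end Summit.Ventures.CertifiedManyBodySolver.Certificates

end
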